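import Mathlib
import Literature.Analysis.Matrix.HadamardInequality
import Literature.NumberTheory.DiophantineApproximation.VandermondeDiscrepancy

/-!
# The Vandermonde product bound `∏_{i≠j} |z_i - z_j| ≤ d^d · M(z)^{2(d-1)}` (venture `DiscreteObjects`, target L)

Cell `pub-namedobj`, seat `pub-namedobj-mahler-g26`. Framing: lottery ticket; floor = certified bounds/negative ranges.

[cite: MckeeSmyth2021, Lemma 3.7]: for `z = (z_1, …, z_d) ∈ ℂ^d`,
`∏_{i ≠ j} |z_i - z_j| ≤ (M(z)² d)^d` where `M(z) = ∏_i max(1, |z_i|)`; here in the slightly sharper printed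
intermediate form `≤ d^d · M(z)^{2(d-1)}`.  Proof as printed: the left side is `|det V(z)|²` for the Vandermonde matrix
(`Literature…Discrepancy.vandermondeAbs`, `prod_Ioi_sq_eq_prod_erase`), and Hadamard's inequality
(`Literature.Analysis.Matrix.norm_det_sq_le_of_entry_le`, row entries `|z_i^k| ≤ max(1,|z_i|)^{d-1}`) bounds it.
REPLICATION; a brick for the cell's planned kernel proof of the weak Dobrowolski bound `M(α) > 1 + 1/(22d)`
([MckeeSmyth2021, Thm 3.11]) — applied there to the `2d` points `(α_i^p, α_i)`.
-/

namespace Summit.Ventures.DiscreteObjects.Mahler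

open Finset Literature.NumberTheory.DiophantineApproximation.Discrepancy

/-- `∏_{i ≠ j} |z_i - z_j| = |V(z)|²`. -/
theorem prod_erase_norm_sub_eq_vandermondeAbs_sq {d : ℕ} (z : Fin d → ℂ) :
    ∏ i, ∏ j ∈ univ.erase i, ‖z i - z j‖ = vandermondeAbs z ^ 2 := by
  rw [← prod_Ioi_sq_eq_prod_erase (fun i j => ‖z i - z j‖) (fun i j => norm_sub_rev _ _)]
  unfold vandermondeAbs
  congr 1
  refine Finset.prod_congr rfl fun i _ => Finset.prod_congr rfl fun j _ => ?_
  exact norm_sub_rev _ _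

/-- **[MckeeSmyth2021, Lemma 3.7]** `∏_{i ≠ j} |z_i - z_j| ≤ d^d · (∏_i max(1,|z_i|))^{2(d-1)}`. -/
theorem prod_erase_norm_sub_le {d : ℕ} (z : Fin d → ℂ) :
    ∏ i, ∏ j ∈ univ.erase i, ‖z i - z j‖ ≤ (d : ℝ) ^ d * (∏ i, max 1 ‖z i‖) ^ (2 * (d - 1)) := by
  rw [prod_erase_norm_sub_eq_vandermondeAbs_sq, vandermondeAbs_eq_norm_det]
  have h := Literature.Analysis.Matrix.norm_det_sq_le_of_entry_le (Matrix.vandermonde z)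
    (fun i => (max 1 ‖z i‖) ^ (d - 1)) (fun i j => by
      rw [Matrix.vandermonde_apply, norm_pow]
      calc ‖z i‖ ^ (j : ℕ) ≤ (max 1 ‖z i‖) ^ (j : ℕ) :=
            pow_le_pow_left₀ (norm_nonneg _) (le_max_right _ _) _
        _ ≤ (max 1 ‖z i‖) ^ (d - 1) := pow_le_pow_right₀ (le_max_left _ _) (by omega))
  refine h.trans (le_of_eq ?_)
  rw [Finset.prod_mul_distrib, Finset.prod_const, Finset.card_univ, Fintype.card_fin, ← Finset.prod_pow]
  congr 1
  refine Finset.prod_congr rfl fun i _ => ?_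
  rw [← pow_mul, mul_comm]

/-- The printed form of [MckeeSmyth2021, Lemma 3.7]: `∏_{i ≠ j} |z_i - z_j| ≤ (M(z)² · d)^d`. -/
theorem prod_erase_norm_sub_le' {d : ℕ} (z : Fin d → ℂ) :
    ∏ i, ∏ j ∈ univ.erase i, ‖z i - z j‖ ≤ ((∏ i, max 1 ‖z i‖) ^ 2 * d) ^ d := by
  refine (prod_erase_norm_sub_le z).trans ?_
  have hM : 1 ≤ ∏ i, max 1 ‖z i‖ := by
    have : ∏ i : Fin d, (1 : ℝ) ≤ ∏ i, max 1 ‖z i‖ :=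
      Finset.prod_le_prod (fun _ _ => zero_le_one) fun _ _ => le_max_left _ _
    simpa using this
  rw [mul_pow, ← pow_mul, mul_comm]
  refine mul_le_mul_of_nonneg_right ?_ (by positivity)
  exact pow_le_pow_right₀ hM (by omega)

end Summit.Ventures.DiscreteObjects.Mahler
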